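import Summits.AtomisticToContinuum.HydrodynamicLimit.Theorems.CollisionIsometryCLTDiffuseBackwardInfluencePairGeneric
import Summits.AtomisticToContinuum.HydrodynamicLimit.Theorems.CollisionIsometryCLTDiffuseBackwardInfluencePairFunctionals
import Summits.AtomisticToContinuum.HydrodynamicLimit.Theorems.CollisionIsometryCLTDiffuseBackwardInfluencePairSlots
import HarnessLib

/-!
# `DiffuseBackwardInfluence`, line `share-nondegeneracy-one-flight`, skeleton v8 — helper PROC1: the marked pair process of one
source along the fold (stmt-AtomisticToContinuum-12950, for `stub_pairPathBound`)

§L the hop kernel `K` is stochastic and transports the tracer law; §N the marked profiles `Tm`/`Am` (…PairDefs §3) are nonnegative,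
`Am` vanishes on the diagonal and at `s = 0`; §P support (marks `≤ n`, tags `≤ cnt n ≤ S`, SCORES ≤ RESOLVED SLOTS, scores `≤` tag);
§M the MARGINAL IDENTITIES (marks summed out give `μ ⊗ μ`; registered headline `pairPath_marginal`), the re-merge flow is `mergeAt`;
§E the effective score increment `dltR` and the score condition `(1−f)² + f² + f(1−f) ≤ 1 − η(1−η)` at an effective score.
-/

namespace Summit.AtomisticToContinuum.HydrodynamicLimit.Theorems.DiffuseBackwardInfluenceShare

open scoped BigOperators Topology ENNReal InnerProductSpace Classical
open Filter Set MeasureTheory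
open Literature.Analysis.FluidPDE (Config HardSphereFlow collidePair)
open Literature.MathematicalPhysics.KineticTheory (localGibbsLaw hsDiameter)
open Summit.AtomisticToContinuum.HydrodynamicLimit.Theorems.DiffuseBackwardInfluenceNeg

noncomputable section

namespace PairPath

section Process

variable {N : ℕ} {C : OnePath.Src N}

/-! ### §L The hop kernel of the source and the tracer law -/

/-- A weighted column sum of the kernel: the two host rows and, off the pair, the identity row
(adapted from `sum_mul_kstep_mul_kstep` of …PairGeneric.lean). -/
private theorem sum_mul_kstep {p q : Fin (N + 1)} (hpq : p ≠ q) {f : Fin (N + 1) → ℝ} (w : Fin (N + 1) → ℝ)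
    (i : Fin (N + 1)) : ∑ i', w i' * kstep p q f i' i =
      w p * kstep p q f p i + w q * kstep p q f q i + (if i = p ∨ i = q then 0 else w i) := by
  rw [← Finset.add_sum_erase _ _ (Finset.mem_univ p),
    ← Finset.add_sum_erase _ _ (Finset.mem_erase.2 ⟨hpq.symm, Finset.mem_univ q⟩), ← add_assoc]
  congr 1
  have hS : ∀ i' ∈ (Finset.univ.erase p).erase q, w i' * kstep p q f i' i = if i = i' then w i else 0 := by
    intro i' hi'
    simp only [Finset.mem_erase, Finset.mem_univ, and_true] at hi'
    rw [kstep_of_ne f hi'.2 hi'.1]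
    split_ifs with h <;> simp [h]
  rw [Finset.sum_congr rfl hS, Finset.sum_ite_eq]
  by_cases hp : i = p
  · simp [hp]
  by_cases hq : i = q
  · simp [hq]
  simp [hp, hq]

/-- Only the identity row feeds an untouched particle. -/
private theorem kstep_eq_zero_of_ne (f : Fin (N + 1) → ℝ) {p q i' i : Fin (N + 1)} (hp : i ≠ p) (hq : i ≠ q)
    (hi : i ≠ i') : kstep p q f i' i = 0 := by
  simp only [kstep, if_neg hp, if_neg hq, if_neg hi, ite_self]

/-- The source's kernel is nonnegative. [folklore] -/
theorem K_nonneg (n : ℕ) (i' i : Fin (N + 1)) : 0 ≤ K C n i' i := by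
  by_cases h : (pairsAt C.σ N C.y n).Nonempty
  · rw [K_eq_kstep_of h]
    exact kstep_nonneg (OnePath.fr_nonneg _ _) (OnePath.fr_le_one _ _) (OnePath.fr_nonneg _ _)
      (OnePath.fr_le_one _ _) _ _
  · rw [K_of_not h]; split_ifs <;> norm_num

/-- The source's kernel is stochastic. [folklore] -/
theorem sum_K (n : ℕ) (i' : Fin (N + 1)) : ∑ i, K C n i' i = 1 := by
  by_cases h : (pairsAt C.σ N C.y n).Nonempty
  · simp_rw [K_eq_kstep_of h]; exact sum_kstep (some_fst_ne_some_snd h) _ _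
  · simp_rw [K_of_not h, Finset.sum_ite_eq', Finset.mem_univ, if_true]

/-- The tracer law is transported by the hop kernel (`OnePath.mu_succ_eq_ite` in kernel form). [folklore] -/
theorem mu_succ_eq_sum (n : ℕ) (i : Fin (N + 1)) : OnePath.mu C (n + 1) i = ∑ i', OnePath.mu C n i' * K C n i' i := by
  by_cases h : (pairsAt C.σ N C.y n).Nonempty
  · have hpq := some_fst_ne_some_snd h
    simp_rw [K_eq_kstep_of h]
    rw [sum_mul_kstep hpq, kstep_fst, kstep_snd hpq, OnePath.mu_succ_eq_ite h]
    by_cases hp : i = h.some.1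
    · subst hp; simp [hpq]; ring
    by_cases hq : i = h.some.2
    · subst hq; simp [hpq.symm]; ring
    simp [hp, hq]
  · simp_rw [K_of_not h, OnePath.mu_succ_of_ne fun h' => absurd h' h]
    simp

/-! ### §N Nonnegativity, diagonal, first split -/

/-- Nonnegativity of both profiles (joint induction along the fold). -/
private theorem nonneg (n : ℕ) : (∀ i s t, 0 ≤ Tm C n i s t) ∧ (∀ i j s t g, 0 ≤ Am C n i j s t g) := by
  induction n with
  | zero => exact ⟨fun i s t => by rw [Tm_zero]; split_ifs <;> norm_num, fun i j s t g => (Am_zero i j s t g).ge⟩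
  | succ n ih =>
    by_cases h : (pairsAt C.σ N C.y n).Nonempty
    · rw [Tm_succ_of h, Am_succ_of h]
      exact step_nonneg (OnePath.fr_nonneg _ _) (OnePath.fr_le_one _ _) (OnePath.fr_nonneg _ _)
        (OnePath.fr_le_one _ _) _ _ _ ih.1 ih.2
    · rw [Tm_succ_of_not h, Am_succ_of_not h]; exact ih

/-- Together mass is nonnegative. [folklore] -/
theorem Tm_nonneg (n : ℕ) (i : Fin (N + 1)) (s t : ℕ) : 0 ≤ Tm C n i s t :=
  (nonneg n).1 i s t

/-- Apart mass is nonnegative. [folklore] -/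
theorem Am_nonneg (n : ℕ) (i j : Fin (N + 1)) (s t g : ℕ) : 0 ≤ Am C n i j s t g :=
  (nonneg n).2 i j s t g

/-- Apart mass vanishes on the diagonal. [folklore] -/
theorem Am_diag (n : ℕ) (i : Fin (N + 1)) (s t g : ℕ) : Am C n i i s t g = 0 := by
  induction n with
  | zero => rfl
  | succ n ih =>
    by_cases h : (pairsAt C.σ N C.y n).Nonempty
    · rw [Am_succ_of h]; exact stepA_diag _ _ _ _ _ _ _ _ _ _ _
    · rw [Am_succ_of_not h]; exact ih

/-- Apart mass has undergone at least one split. [folklore] -/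
theorem Am_zero_splits (n : ℕ) (i j : Fin (N + 1)) (t g : ℕ) : Am C n i j 0 t g = 0 := by
  induction n generalizing i j t g with
  | zero => rfl
  | succ n ih =>
    by_cases h : (pairsAt C.σ N C.y n).Nonempty
    · rw [Am_succ_of h]; exact stepA_zero_splits _ _ _ _ _ _ ih i j t g
    · rw [Am_succ_of_not h]; exact ih i j t g

/-! ### §P Support of the marks -/

/-- Crude support of both profiles (joint induction along the fold, `step_support`). -/
private theorem support (n : ℕ) : (∀ i s t, (n + 1 ≤ s ∨ n + 1 ≤ t) → Tm C n i s t = 0) ∧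
    (∀ i j s t g, (n + 1 ≤ s ∨ n + 1 ≤ t ∨ S C < g) → Am C n i j s t g = 0) := by
  induction n with
  | zero => exact ⟨fun i s t h => by rw [Tm_zero, if_neg fun ⟨_, hs, ht⟩ => by omega], fun i j s t g _ => Am_zero i j s t g⟩
  | succ n ih =>
    by_cases h : (pairsAt C.σ N C.y n).Nonempty
    · rw [Tm_succ_of h, Am_succ_of h]
      obtain ⟨hT, hA⟩ := step_support h.some.1 h.some.2 (OnePath.fr C n) (dlt_le_one (C := C) n) (S C) (cnt C n)
        ih.1 ih.2
      have hc := cnt_le (C := C) n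
      exact ⟨fun i s t hst => hT i s t (by omega), fun i j s t g hstg => hA i j s t g (by omega)⟩
    · rw [Tm_succ_of_not h, Am_succ_of_not h]
      exact ⟨fun i s t hst => ih.1 i s t (by omega), fun i j s t g hstg => ih.2 i j s t g (by omega)⟩

/-- Crude support: after `n` steps no mark exceeds `n`, and no tag exceeds the grid size. [folklore] -/
theorem Tm_eq_zero_of (n : ℕ) (i : Fin (N + 1)) {s t : ℕ} (h : n < s ∨ n < t) : Tm C n i s t = 0 :=
  (support n).1 i s t (by omega)

/-- Crude support, apart profile. [folklore] -/
theorem Am_eq_zero_of (n : ℕ) (i j : Fin (N + 1)) {s t g : ℕ} (h : n < s ∨ n < t ∨ S C < g) : Am C n i j s t g = 0 :=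
  (support n).2 i j s t g (by omega)

/-- Tags never exceed the number of started slots. [folklore] -/
theorem Am_eq_zero_of_cnt_lt (n : ℕ) (i j : Fin (N + 1)) (s t : ℕ) {g : ℕ} (h : cnt C n < g) : Am C n i j s t g = 0 := by
  induction n generalizing i j s t g with
  | zero => rfl
  | succ n ih =>
    have hc : cnt C n ≤ cnt C (n + 1) := cnt_mono (Nat.le_succ n)
    by_cases hn : (pairsAt C.σ N C.y n).Nonempty
    · rw [Am_succ_of hn]
      have hA : ∀ i j s t g, (n + 1 ≤ s ∨ n + 1 ≤ t ∨ cnt C n < g) → Am C n i j s t g = 0 := fun i j s t g hh =>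
        hh.elim (fun hh => Am_eq_zero_of n i j (by omega)) fun hh => hh.elim (fun hh => Am_eq_zero_of n i j (by omega)) (ih i j s t)
      exact (step_support hn.some.1 hn.some.2 (OnePath.fr C n) (dlt_le_one (C := C) n) (S C) (cnt C n)
        (support n).1 hA).2 i j s t g (Or.inr (Or.inr ⟨by omega, by omega⟩))
    · rw [Am_succ_of_not hn]; exact ih i j s t (by omega)

/-- SCORES ≤ RESOLVED SLOTS and SCORES ≤ TAG (joint induction along the fold). -/
private theorem resolved (n : ℕ) : (∀ i s t, cnt C n - gap C n i < t → Tm C n i s t = 0) ∧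
    (∀ i j s t g, g < t → Am C n i j s t g = 0) := by
  induction n with
  | zero => exact ⟨fun i s t h => by rw [Tm_zero, if_neg fun h' => absurd h'.2.2 (by omega)], fun i j s t g _ => Am_zero i j s t g⟩
  | succ n ih =>
    obtain ⟨ihT, ihA⟩ := ih
    have hc : cnt C n ≤ cnt C (n + 1) := cnt_mono (Nat.le_succ n)
    by_cases h : (pairsAt C.σ N C.y n).Nonempty
    · rw [Tm_succ_of h, Am_succ_of h]
      have hpq := some_fst_ne_some_snd h
      set p := h.some.1 with hp
      set q := h.some.2 with hq
      -- shifted together mass of a host vanishes above `cnt n` (a score needs `gap ≥ 1`)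
      have hhost : ∀ r s t, cnt C n < t → Tm C n r s (t - dlt C n r) = 0 := by
        intro r s t ht
        refine ihT r s _ ?_
        have hg := gap_le_cnt (C := C) n r
        unfold dlt; split_ifs with h1
        exacts [by have := h1.1; omega, by omega]
      have hres : ∀ i, cnt C (n + 1) - gap C (n + 1) i = if i = p ∨ i = q then cnt C n else cnt C n - gap C n i := by
        intro i
        split_ifs with hi
        · rw [gap_succ_of_touches ((touches_iff_of h i).2 hi)]; omega
        · rw [gap_succ_of_not_touches fun ht => hi ((touches_iff_of h i).1 ht)]
          have hg := gap_le_cnt (C := C) n i; omega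
      refine ⟨fun i s t ht => ?_, fun i j s t g hg => ?_⟩
      · rw [hres] at ht
        have e4 : ∀ i' j' g, Am C n i' j' s t g * (kstep p q (OnePath.fr C n) i' i * kstep p q (OnePath.fr C n) j' i) = 0 := by
          intro i' j' g
          by_cases hi : i = p ∨ i = q
          · rw [if_pos hi] at ht
            rcases Nat.lt_or_ge g t with hgt | hgt
            · rw [ihA _ _ _ _ _ hgt, zero_mul]
            · rw [Am_eq_zero_of_cnt_lt n i' j' s t (by omega), zero_mul]
          · obtain ⟨hip, hiq⟩ := not_or.1 hi
            by_cases h1 : i = i'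
            · by_cases h2 : i = j'
              · rw [← h1, ← h2, Am_diag, zero_mul]
              · rw [kstep_eq_zero_of_ne _ hip hiq h2, mul_zero, mul_zero]
            · rw [kstep_eq_zero_of_ne _ hip hiq h1, zero_mul, mul_zero]
        simp only [stepT, e4, Finset.sum_const_zero, add_zero]
        by_cases hi : i = p ∨ i = q
        · rw [if_pos hi] at ht
          have e : ∀ r, (if dlt C n r ≤ t then kstep p q (OnePath.fr C n) r i ^ 2 * Tm C n r s (t - dlt C n r) else 0) = 0 :=
            fun r => ite_eq_right_iff.2 fun _ => by rw [hhost r s t ht, mul_zero]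
          simp only [if_pos hi, e, add_zero]
        · obtain ⟨hip, hiq⟩ := not_or.1 hi
          rw [if_neg hi] at ht
          simp [hi, ihT i s t ht, kstep_eq_zero_of_ne _ hip hiq hip, kstep_eq_zero_of_ne _ hip hiq hiq]
      · simp only [stepA]
        by_cases hij : i = j
        · rw [if_pos hij]
        rw [if_neg hij, Finset.sum_eq_zero fun i' _ => Finset.sum_eq_zero fun j' _ => by rw [ihA _ _ _ _ _ hg, zero_mul],
          zero_add]
        refine ite_eq_right_iff.2 fun ⟨h1, _⟩ => ?_
        have e : ∀ r, (if dlt C n r ≤ t then Tm C n r (s - 1) (t - dlt C n r) *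
            (kstep p q (OnePath.fr C n) r i * kstep p q (OnePath.fr C n) r j) else 0) = 0 :=
          fun r => ite_eq_right_iff.2 fun _ => by rw [hhost r (s - 1) t (by omega), zero_mul]
        rw [e, e, add_zero]
    · rw [Tm_succ_of_not h, Am_succ_of_not h]
      refine ⟨fun i s t ht => ihT i s t ?_, ihA⟩
      rw [gap_succ_of_not_touches (not_touches_of_not h i)] at ht
      have := gap_le_cnt (C := C) n i; omega

/-- SCORES ≤ RESOLVED SLOTS: together mass on `i` has scored at most `cnt n − gap n i` times. [folklore] -/
theorem Tm_eq_zero_of_resolved_lt (n : ℕ) (i : Fin (N + 1)) (s : ℕ) {t : ℕ} (h : cnt C n - gap C n i < t) :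
    Tm C n i s t = 0 :=
  (resolved n).1 i s t h

/-- Apart mass has scored at most `tag` times. [folklore] -/
theorem Am_eq_zero_of_tag_lt (n : ℕ) (i j : Fin (N + 1)) (s : ℕ) {t g : ℕ} (h : g < t) : Am C n i j s t g = 0 :=
  (resolved n).2 i j s t g h

/-! ### §M Marginals: the marked process refines the product of the tracer laws -/

/-- THE MARGINAL IDENTITIES (box of size `K + 2` for the marks `s, t`, tags `≤ S`): for every `n ≤ K`, summing out the marks of the
together profile gives `μ_n(i)²` and of the apart profile gives `μ_n(i) μ_n(j)` off the diagonal. [folklore] -/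
theorem marginal (K : ℕ) : ∀ n, n ≤ K →
    (∀ i, sT (K + 2) (Tm C n) i = OnePath.mu C n i ^ 2) ∧
      (∀ i j, sA (K + 2) (S C) (Am C n) i j = if i = j then 0 else OnePath.mu C n i * OnePath.mu C n j) := by
  intro n
  induction n with
  | zero =>
    intro _
    refine ⟨fun i => ?_, fun i j => ?_⟩
    · simp only [sT, Tm_zero, OnePath.mu_zero]
      rw [Finset.sum_eq_single_of_mem 0 (by simp) fun s _ hs => Finset.sum_eq_zero fun t _ => if_neg (by simp [hs]),
        Finset.sum_eq_single_of_mem 0 (by simp) fun t _ ht => if_neg (by simp [ht])]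
      by_cases hi : i = C.k <;> simp [hi]
    · simp only [sA, Am_zero, Finset.sum_const_zero, OnePath.mu_zero]
      split_ifs with h1 h2 h3 <;> first | rfl | exact absurd (h2.trans h3.symm) h1 | simp
  | succ n ih =>
    intro hn
    obtain ⟨ihT, ihA⟩ := ih (Nat.le_of_succ_le hn)
    by_cases h : (pairsAt C.σ N C.y n).Nonempty
    · have hpq := some_fst_ne_some_snd h
      have hTs : ∀ i t, Tm C n i (K + 2 - 1) t = 0 := fun i t => Tm_eq_zero_of n i (by omega)
      have hTt : ∀ i s, Tm C n i s (K + 2 - 1) = 0 := fun i s => Tm_eq_zero_of n i (by omega)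
      obtain ⟨h1, h2⟩ := product_step hpq (OnePath.fr C n) (dlt_le_one (C := C) n) (show 1 ≤ K + 2 by omega)
        (cnt_le (C := C) n) hTs hTt ihT ihA
      have hmu : ∀ i, ∑ i', OnePath.mu C n i' * kstep h.some.1 h.some.2 (OnePath.fr C n) i' i =
          OnePath.mu C (n + 1) i := by
        intro i; rw [mu_succ_eq_sum]; simp_rw [K_eq_kstep_of h]
      rw [Tm_succ_of h, Am_succ_of h]
      exact ⟨fun i => by rw [h1, hmu], fun i j => by rw [h2, hmu, hmu]⟩
    · have hmu : ∀ i, OnePath.mu C (n + 1) i = OnePath.mu C n i := fun i =>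
        OnePath.mu_succ_of_ne fun h' => absurd h' h
      rw [Tm_succ_of_not h, Am_succ_of_not h]
      simp only [hmu]
      exact ⟨ihT, ihA⟩

/-- Together mass is bounded by the together probability of its host. [folklore] -/
theorem Tm_le_mu_sq (n : ℕ) (i : Fin (N + 1)) (s t : ℕ) : Tm C n i s t ≤ OnePath.mu C n i ^ 2 := by
  by_cases hst : n < s ∨ n < t
  · rw [Tm_eq_zero_of n i hst]; positivity
  rw [← (marginal n n le_rfl).1 i]
  exact (Finset.single_le_sum (f := fun t' => Tm C n i s t') (fun t' _ => Tm_nonneg n i s t')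
    (Finset.mem_range.2 (by omega))).trans (Finset.single_le_sum (f := fun s' => ∑ t' ∈ Finset.range (n + 2), Tm C n i s' t')
      (fun s' _ => Finset.sum_nonneg fun t' _ => Tm_nonneg n i s' t') (Finset.mem_range.2 (by omega)))

/-- A host without tracer mass carries no together mass. [folklore] -/
theorem Tm_eq_zero_of_mu_eq_zero {n : ℕ} {i : Fin (N + 1)} (h : OnePath.mu C n i = 0) (s t : ℕ) : Tm C n i s t = 0 :=
  le_antisymm (by simpa [h] using Tm_le_mu_sq (C := C) n i s t) (Tm_nonneg n i s t)

/-- THE RE-MERGE FLOW OF THE MARKED PROCESS IS THE LANDED MERGE MASS `mergeAt` (`OnePath.mergeAt_eq`). [folklore] -/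
theorem remFlow_eq_mergeAt {K n : ℕ} (hn : n ≤ K) (h : (pairsAt C.σ N C.y n).Nonempty) :
    remFlow h.some.1 h.some.2 (OnePath.fr C n) (K + 2) (S C) (Am C n) = mergeAt C.σ N C.y C.k n := by
  have hpq := some_fst_ne_some_snd h
  rw [OnePath.mergeAt_eq h]
  set p := h.some.1 with hp
  set q := h.some.2 with hq
  obtain ⟨ihT, ihA⟩ := marginal K n hn
  have hTs : ∀ i t, Tm C n i (K + 2 - 1) t = 0 := fun i t => Tm_eq_zero_of n i (by omega)
  have hTt : ∀ i s, Tm C n i s (K + 2 - 1) = 0 := fun i s => Tm_eq_zero_of n i (by omega)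
  have hU : 1 ≤ K + 2 := by omega
  have h1 := (product_step hpq (OnePath.fr C n) (dlt_le_one (C := C) n) hU (cnt_le (C := C) n) hTs hTt ihT ihA).1
  have h3 : ∀ i, ∑ i', ∑ j', sA (K + 2) (S C) (Am C n) i' j' *
      (kstep p q (OnePath.fr C n) i' i * kstep p q (OnePath.fr C n) j' i) =
      (OnePath.mu C n p * kstep p q (OnePath.fr C n) p i + OnePath.mu C n q * kstep p q (OnePath.fr C n) q i +
          (if i = p ∨ i = q then 0 else OnePath.mu C n i)) ^ 2 -
        ((if i = p ∨ i = q then 0 else OnePath.mu C n i ^ 2) + kstep p q (OnePath.fr C n) p i ^ 2 * OnePath.mu C n p ^ 2 +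
          kstep p q (OnePath.fr C n) q i ^ 2 * OnePath.mu C n q ^ 2) := by
    intro i
    have e := h1 i
    rw [sT_stepT hpq _ (dlt_le_one (C := C) n) hU (S C) hTt, sum_mul_kstep hpq] at e
    simp only [ihT] at e
    linarith [e]
  simp only [remFlow, h3]
  rw [Fintype.sum_eq_add p q hpq fun i ⟨hip, hiq⟩ => ?_]
  · simp [kstep_fst, kstep_snd hpq, hpq, hpq.symm]; ring
  · simp [if_neg (not_or.2 ⟨hip, hiq⟩), kstep_eq_zero_of_ne _ hip hiq hip, kstep_eq_zero_of_ne _ hip hiq hiq]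

/-! ### §E The effective score increment (restricted to the reflected pair and to massive hosts) -/

variable (C) in
/-- The EFFECTIVE score increment at step `n` with reflected pair `(p, q)`: `dlt` restricted to the two hosts and to hosts carrying tracer
mass (a massless host carries no together mass, so its increment is immaterial). -/
def dltR (n : ℕ) (p q i : Fin (N + 1)) : ℕ :=
  if (i = p ∨ i = q) ∧ dlt C n i = 1 ∧ OnePath.mu C n i ≠ 0 then 1 else 0

/-- `dltR ≤ 1`. [folklore] -/
theorem dltR_le_one (n : ℕ) (p q i : Fin (N + 1)) : dltR C n p q i ≤ 1 := by
  unfold dltR; split_ifs <;> omega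

/-- `dltR` vanishes off the pair. [folklore] -/
theorem dltR_of_ne {n : ℕ} {p q i : Fin (N + 1)} (hp : i ≠ p) (hq : i ≠ q) : dltR C n p q i = 0 := by
  unfold dltR; exact if_neg fun h => h.1.elim hp hq

/-- `dltR ≤ dlt` (so `gap − dltR ≥ gap − dlt ≥ 0`). [folklore] -/
theorem dltR_le_dlt (n : ℕ) (p q i : Fin (N + 1)) : dltR C n p q i ≤ dlt C n i := by
  unfold dltR; split_ifs with h
  · exact h.2.1.ge
  · exact Nat.zero_le _

/-- Shifted terms agree for two increments that coincide unless the shifted profile vanishes. -/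
private theorem shift_congr {d₁ d₂ : ℕ} {F : ℕ → ℝ} (h : d₁ = d₂ ∨ ∀ u, F u = 0) (X : ℝ) (t : ℕ) :
    ((if d₁ ≤ t then X * F (t - d₁) else 0) = if d₂ ≤ t then X * F (t - d₂) else 0) ∧
      ((if d₁ ≤ t then F (t - d₁) * X else 0) = if d₂ ≤ t then F (t - d₂) * X else 0) := by
  rcases h with rfl | h
  · exact ⟨rfl, rfl⟩
  · simp [h]

/-- CONGRUENCE: the process may be stepped with the effective increment (the together profile does not see `δ` at massless hosts). [folklore] -/
theorem Tm_succ_eq_dltR {n : ℕ} (h : (pairsAt C.σ N C.y n).Nonempty) :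
    Tm C (n + 1) = stepT h.some.1 h.some.2 (OnePath.fr C n) (dltR C n h.some.1 h.some.2) (S C) (Tm C n) (Am C n) ∧
      Am C (n + 1) = stepA h.some.1 h.some.2 (OnePath.fr C n) (dltR C n h.some.1 h.some.2) (cnt C n) (Tm C n) (Am C n) := by
  have key : ∀ r, (r = h.some.1 ∨ r = h.some.2) → ∀ s,
      dlt C n r = dltR C n h.some.1 h.some.2 r ∨ ∀ u, Tm C n r s u = 0 := by
    intro r hr s
    by_cases hμ : OnePath.mu C n r = 0
    · exact Or.inr fun u => Tm_eq_zero_of_mu_eq_zero hμ s u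
    refine Or.inl ?_
    unfold dltR
    by_cases hd : dlt C n r = 1
    · rw [if_pos ⟨hr, hd, hμ⟩, hd]
    · have := dlt_le_one (C := C) n r
      rw [if_neg fun h' => hd h'.2.1]; omega
  rw [Tm_succ_of h, Am_succ_of h]
  refine ⟨funext fun i => funext fun s => funext fun t => ?_,
    funext fun i => funext fun j => funext fun s => funext fun t => funext fun g => ?_⟩
  · simp only [stepT]
    rw [(shift_congr (key _ (Or.inl rfl) s) _ t).1, (shift_congr (key _ (Or.inr rfl) s) _ t).1]
  · simp only [stepA]
    rw [(shift_congr (key _ (Or.inl rfl) (s - 1)) _ t).2, (shift_congr (key _ (Or.inr rfl) (s - 1)) _ t).2]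

/-- THE SCORE CONDITION at an effective score (weight `λ = 1/2`, `ρ₁ = 1 − η(1−η)`): the host's first collision of the current slot is
`η`-non-degenerate and the host carries mass, so its fraction `f` lies in `[η, 1−η]` and `(1−f)² + f² + f(1−f) = 1 − f(1−f) ≤ 1 − η(1−η)`.
Needs `n < fin` (the scoring step lies in the window) through `cfirst_of_gap_pos`. [folklore] -/
theorem score_condition (hΔ : 0 < C.Δ) (hpos : 0 < OnePath.fin C) (hm : 1 ≤ C.m) (hL : 1 ≤ C.L) {n : ℕ}
    (hn : n < OnePath.fin C) (h : (pairsAt C.σ N C.y n).Nonempty) (i : Fin (N + 1))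
    (hi : dltR C n h.some.1 h.some.2 i = 1) :
    (1 - OnePath.fr C n i) ^ 2 + OnePath.fr C n i ^ 2 + 2 * OnePath.fr C n i * (1 - OnePath.fr C n i) * (1 / 2) ≤
      1 - C.η * (1 - C.η) := by
  unfold dltR at hi
  split_ifs at hi with hc
  obtain ⟨hpq, hd, hμ⟩ := hc
  have hg : 1 ≤ gap C n i ∧ i ∈ OnePath.Good C (cnt C n - 1) := by
    unfold dlt at hd; split_ifs at hd with hg; exact hg
  obtain ⟨-, hc⟩ := cfirst_of_gap_pos hΔ hpos hm hL hn ((touches_iff_of h i).2 hpq) hg.1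
  rcases fr_mem_of_good hg.2 hc with h0 | ⟨h1, h2⟩
  · exact absurd h0 hμ
  · nlinarith [mul_nonneg (sub_nonneg.2 h1) (sub_nonneg.2 h2)]

end Process

/-- REGISTERED HEADLINE (sub-goal `pairPath_marginal`): the marked pair process refines the product of the tracer laws. [folklore] -/
theorem pairPath_marginal : ∀ (N : ℕ) (C : OnePath.Src N) (K n : ℕ), n ≤ K → (∀ i, PairPath.sT (K + 2) (PairPath.Tm C n) i = OnePath.mu C n i ^ 2) ∧ (∀ i j, PairPath.sA (K + 2) (PairPath.S C) (PairPath.Am C n) i j = if i = j then 0 else OnePath.mu C n i * OnePath.mu C n j) :=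
  fun _ _ K n hn => marginal K n hn

end PairPath

end

end Summit.AtomisticToContinuum.HydrodynamicLimit.Theorems.DiffuseBackwardInfluenceShare
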